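import Summits.Ventures.HodgeRepro2.T5BergmanCoeffExpansion

/-!
# Schur orthogonality for the weighted Bergman model with BOTH vectors arbitrary

For the weight-`k` model (`k ≥ 2`) of the holomorphic discrete series of `SU(1,1)` on the disc, and
Rühl's Haar measure `μ_R = ν/π` (`T5SU11CoefficientL2.ruhl`), this file proves the **general Schur
orthogonality relation**

  `∫_G |⟨π_k(g) f, h⟩_k|² dμ_R = ⟨f, f⟩_k ⟨h, h⟩_k / (k - 1)`   for ALL `f, h ∈ A_k`

(`integral_norm_matrixCoeff_sq_ruhl`) — the formal degree `d(π_k) = k - 1 = 2 k_R - 1` is the same for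
every pair of vectors — together with the square-integrability of every matrix coefficient
(`integrable_norm_matrixCoeff_sq`). The case `f = 1` is `T5BergmanSchur.integral_norm_coeffLowest_sq_ruhl`;
the present theorem removes the restriction on the first vector.

The proof: by `T5BergmanCoeffExpansion.hasSum_integral_norm_matrixCoeff_sq`,
`Q(f) := ∫ |⟨π_k(g) f, h⟩_k|² dμ_R = Σ_m |a_m|² Q(zᵐ)` along the Taylor coefficients of `f`. For the
coherent states `f = K_z` the left side is known (a right translate of the lowest-weight coefficient):
`Q(K_z) = ⟨K_z, K_z⟩_k ⟨h, h⟩_k / (k - 1)` (`integral_norm_matrixCoeff_kernel_sq_ruhl`), and with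
`|a_m(K_z)|² = C(m+k-1, m)² |z|^{2m}` and `⟨K_z, K_z⟩_k = π/(k-1) Σ_m C(m+k-1, m) |z|^{2m}` this gives two
power series in `x = |z|² ∈ [0, 1)` with non-negative coefficients and the same sum; the uniqueness of
such coefficients (`coeff_eq_of_hasSum_eq`) yields the **monomial Schur relation**
`Q(zᵐ) = ⟨zᵐ, zᵐ⟩_k ⟨h, h⟩_k / (k - 1)` (`integral_norm_matrixCoeff_monomial_sq_ruhl`), and Parseval in `A_k`
(`hasSum_pairing_self`) finishes.

Blind lane: Mathlib + the HodgeRepro2 prefix only; no sorry; axioms ⊆ {propext, Classical.choice,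
Quot.sound}.
-/

namespace Summit.Ventures.HodgeRepro2.T5BergmanSchurGeneral

open MeasureTheory MeasureTheory.Measure Metric Filter Topology
open T5PoincareDensity T5SU11Unimodular T5SU11Fibration T5HaarCircle T5SU11CoefficientL2
open T5BergmanCoefficient T5BergmanPairing T5BergmanUnitary T5BergmanFourier T5BergmanKernel
  T5BergmanParseval T5BergmanPointwise T5BergmanProjection T5BergmanCoefficientL2 T5BergmanKTypes
  T5BergmanActStable T5BergmanMatrixCoeff T5BergmanCoeffOrtho T5BergmanSchur T5BergmanCoeffL2
  T5BergmanCoeffExpansion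
open scoped Real

/-! ### Uniqueness of the coefficients of a power series with non-negative coefficients -/

/-- The shifted series `Σ d_{m+1} x^m` of a series vanishing on `(0, 1)`: `HasSum` to `-d_0 / x`. -/
lemma hasSum_shift_of_hasSum_zero {d : ℕ → ℝ}
    (h0 : ∀ x ∈ Set.Ioo (0 : ℝ) 1, HasSum (fun m => d m * x ^ m) 0) {x : ℝ}
    (hx : x ∈ Set.Ioo (0 : ℝ) 1) : HasSum (fun m => d (m + 1) * x ^ m) (-d 0 / x) := by
  have h1 := (hasSum_nat_add_iff' 1).mpr (h0 x hx)
  simp only [Finset.sum_range_one, pow_zero, mul_one, zero_sub] at h1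
  have h2 := h1.div_const x
  have e : (fun m => d (m + 1) * x ^ (m + 1) / x) = fun m => d (m + 1) * x ^ m := by
    funext m
    have : x ≠ 0 := hx.1.ne'
    rw [pow_succ]
    field_simp
  rwa [e] at h2

/-- The shifted series is absolutely summable on `(0, 1)`. -/
lemma summable_shift_abs {d : ℕ → ℝ}
    (hs : ∀ x ∈ Set.Ioo (0 : ℝ) 1, Summable fun m => |d m| * x ^ m) {x : ℝ}
    (hx : x ∈ Set.Ioo (0 : ℝ) 1) : Summable fun m => |d (m + 1)| * x ^ m := by
  have h1 := (hs x hx).comp_injective (add_left_injective 1)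
  have h2 := h1.mul_left x⁻¹
  refine h2.congr fun m => ?_
  simp only [Function.comp_apply]
  have : x ≠ 0 := hx.1.ne'
  rw [pow_succ]
  field_simp

/-- **The constant term of a series vanishing on `(0, 1)` (absolutely summable there) is zero.** -/
lemma head_eq_zero_of_hasSum_zero {d : ℕ → ℝ}
    (h0 : ∀ x ∈ Set.Ioo (0 : ℝ) 1, HasSum (fun m => d m * x ^ m) 0)
    (hs : ∀ x ∈ Set.Ioo (0 : ℝ) 1, Summable fun m => |d m| * x ^ m) : d 0 = 0 := by
  by_contra hd0
  have hpos : 0 < |d 0| := abs_pos.mpr hd0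
  have hhalf : (1 / 2 : ℝ) ∈ Set.Ioo (0 : ℝ) 1 := by norm_num
  have hM : Summable fun m => |d (m + 1)| * (1 / 2 : ℝ) ^ m := summable_shift_abs hs hhalf
  set M := ∑' m, |d (m + 1)| * (1 / 2 : ℝ) ^ m with hMdef
  have hM0 : 0 ≤ M := tsum_nonneg fun m => by positivity
  -- for `x ∈ (0, 1/2]`: `|d 0| ≤ x M`
  have key : ∀ x ∈ Set.Ioo (0 : ℝ) 1, x ≤ 1 / 2 → |d 0| ≤ x * M := by
    intro x hx hx2
    have hsx := hasSum_shift_of_hasSum_zero h0 hx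
    have hsum : Summable fun m => |d (m + 1)| * x ^ m := summable_shift_abs hs hx
    have h1 : ‖-d 0 / x‖ ≤ ∑' m, ‖d (m + 1) * x ^ m‖ := by
      rw [← hsx.tsum_eq]
      refine norm_tsum_le_tsum_norm ?_
      refine hsum.congr fun m => ?_
      rw [norm_mul, Real.norm_eq_abs, Real.norm_eq_abs, abs_of_pos (pow_pos hx.1 m)]
    have h2 : ∑' m, ‖d (m + 1) * x ^ m‖ ≤ M := by
      have e : (fun m => ‖d (m + 1) * x ^ m‖) = fun m => |d (m + 1)| * x ^ m := by
        funext m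
        rw [norm_mul, Real.norm_eq_abs, Real.norm_eq_abs, abs_of_pos (pow_pos hx.1 m)]
      rw [e]
      refine hsum.tsum_le_tsum (fun m => ?_) hM
      exact mul_le_mul_of_nonneg_left (pow_le_pow_left₀ hx.1.le hx2 m) (abs_nonneg _)
    have h3 : |d 0| / x ≤ M := by
      have : ‖-d 0 / x‖ = |d 0| / x := by
        rw [Real.norm_eq_abs, abs_div, abs_neg, abs_of_pos hx.1]
      linarith
    rwa [div_le_iff₀ hx.1, mul_comm] at h3
  -- choose `x` small
  set x : ℝ := min (1 / 2) (|d 0| / (2 * (M + 1))) with hxdef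
  have hx0 : 0 < x := lt_min (by norm_num) (div_pos hpos (by linarith))
  have hx2 : x ≤ 1 / 2 := min_le_left _ _
  have hx3 : x ≤ |d 0| / (2 * (M + 1)) := min_le_right _ _
  have hx : x ∈ Set.Ioo (0 : ℝ) 1 := ⟨hx0, by linarith⟩
  have h := key x hx hx2
  have h4 : x * M ≤ |d 0| / (2 * (M + 1)) * M := mul_le_mul_of_nonneg_right hx3 hM0
  have h5 : |d 0| / (2 * (M + 1)) * M < |d 0| := by
    rw [div_mul_eq_mul_div, div_lt_iff₀ (by linarith)]
    nlinarith
  linarith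

/-- **A series vanishing on `(0, 1)` (absolutely summable there) has all coefficients zero.** -/
theorem eq_zero_of_hasSum_zero {d : ℕ → ℝ}
    (h0 : ∀ x ∈ Set.Ioo (0 : ℝ) 1, HasSum (fun m => d m * x ^ m) 0)
    (hs : ∀ x ∈ Set.Ioo (0 : ℝ) 1, Summable fun m => |d m| * x ^ m) : ∀ m, d m = 0 := by
  intro m
  induction m generalizing d with
  | zero => exact head_eq_zero_of_hasSum_zero h0 hs
  | succ m ih =>
    refine ih (d := fun m => d (m + 1)) (fun x hx => ?_) (fun x hx => summable_shift_abs hs hx)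
    have := hasSum_shift_of_hasSum_zero h0 hx
    rwa [head_eq_zero_of_hasSum_zero h0 hs, neg_zero, zero_div] at this

/-- **Uniqueness of the coefficients**: two power series with non-negative coefficients converging to
the same sum on `[0, 1)` have the same coefficients. -/
theorem coeff_eq_of_hasSum_eq {a b : ℕ → ℝ} (ha : ∀ m, 0 ≤ a m) (hb : ∀ m, 0 ≤ b m) {S : ℝ → ℝ}
    (hS : ∀ x ∈ Set.Ico (0 : ℝ) 1, HasSum (fun m => a m * x ^ m) (S x))
    (hS' : ∀ x ∈ Set.Ico (0 : ℝ) 1, HasSum (fun m => b m * x ^ m) (S x)) : a = b := by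
  have h0 : ∀ x ∈ Set.Ioo (0 : ℝ) 1, HasSum (fun m => (a m - b m) * x ^ m) 0 := by
    intro x hx
    have hx' : x ∈ Set.Ico (0 : ℝ) 1 := ⟨hx.1.le, hx.2⟩
    have := (hS x hx').sub (hS' x hx')
    rw [sub_self] at this
    refine this.congr_fun fun m => ?_
    ring
  have hs : ∀ x ∈ Set.Ioo (0 : ℝ) 1, Summable fun m => |a m - b m| * x ^ m := by
    intro x hx
    have hx' : x ∈ Set.Ico (0 : ℝ) 1 := ⟨hx.1.le, hx.2⟩
    have hsum : Summable fun m => (a m + b m) * x ^ m :=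
      ((hS x hx').summable.add (hS' x hx').summable).congr fun m => by ring
    refine Summable.of_nonneg_of_le (fun m => mul_nonneg (abs_nonneg _) (pow_nonneg hx.1.le m))
      (fun m => ?_) hsum
    refine mul_le_mul_of_nonneg_right ?_ (pow_nonneg hx.1.le m)
    calc |a m - b m| ≤ |a m| + |b m| := abs_sub _ _
      _ = a m + b m := by rw [abs_of_nonneg (ha m), abs_of_nonneg (hb m)]
  funext m
  have := eq_zero_of_hasSum_zero h0 hs m
  linarith

/-! ### The coherent states -/

variable [MeasurableSpace Circle] [BorelSpace Circle]

omit [MeasurableSpace Circle] [BorelSpace Circle] in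
/-- `|a_z|² = (1 - |z|²)⁻¹` for `a_z = mat (sec z) 0 0`. -/
lemma norm_mat_sec_sq {z : ℂ} (hz : z ∈ ball (0 : ℂ) 1) :
    ‖mat (sec z) 0 0‖ ^ 2 = (1 - ‖z‖ ^ 2)⁻¹ := by
  have h := one_sub_norm_orbit_sq (sec z)
  rw [orbit_sec hz] at h
  rw [h, inv_pow, inv_inv]

/-- **Schur orthogonality for the coherent states** against `μ_R`:
`∫ |⟨π_k(g) K_z, h⟩_k|² dμ_R = ⟨K_z, K_z⟩_k ⟨h, h⟩_k / (k - 1)`. -/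
theorem integral_norm_matrixCoeff_kernel_sq_ruhl (k : ℕ) (hk : 2 ≤ k) {z : ℂ} (hz : z ∈ ball (0 : ℂ) 1)
    (b : ℕ → ℂ) (h : ℂ → ℂ) (hh : ∀ w ∈ ball (0 : ℂ) 1, HasSum (fun n => b n * w ^ n) (h w))
    (hhint : IntegrableOn (fun w => ‖h w‖ ^ 2 * (1 - ‖w‖ ^ 2) ^ (k - 2)) (ball (0 : ℂ) 1)) :
    ∫ g, ‖matrixCoeff k (kernel k z) h g‖ ^ 2 ∂ruhl =
      (pairing k (kernel k z) (kernel k z)).re * (pairing k h h).re / ((k : ℝ) - 1) := by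
  rw [(integrable_norm_matrixCoeff_kernel_sq ruhl k hk hz b h hh hhint).2,
    integral_norm_coeffLowest_sq_ruhl k hk b h hh hhint, pairing_lowest_lowest k hk,
    pairing_kernel_self k hk hz, pow_mul, norm_mat_sec_sq hz, Complex.ofReal_re,
    ← Complex.ofReal_mul, Complex.ofReal_re]
  ring

omit [MeasurableSpace Circle] [BorelSpace Circle] in
/-- The squared modulus of the kernel coefficient: `|C(m+k-1, m) z̄^m|² = C(m+k-1, m)² (|z|²)^m`. -/
lemma norm_kernelCoeff_sq (k : ℕ) (z : ℂ) (m : ℕ) :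
    ‖kernelCoeff k z m‖ ^ 2 = (((m + k - 1).choose m : ℕ) : ℝ) ^ 2 * (‖z‖ ^ 2) ^ m := by
  unfold kernelCoeff
  rw [norm_mul, norm_pow, Complex.norm_conj, Complex.norm_natCast, mul_pow, ← pow_mul, ← pow_mul,
    mul_comm m 2]

omit [MeasurableSpace Circle] [BorelSpace Circle] in
/-- **The binomial series** `Σ_m C(m+k-1, m) (|z|²)^m = (1 - |z|²)^{-k}` (the kernel at its own point). -/
lemma hasSum_choose_mul_pow (k : ℕ) (hk : 2 ≤ k) {z : ℂ} (hz : z ∈ ball (0 : ℂ) 1) :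
    HasSum (fun m => (((m + k - 1).choose m : ℕ) : ℝ) * (‖z‖ ^ 2) ^ m) ((1 - ‖z‖ ^ 2)⁻¹ ^ k) := by
  have h := hasSum_kernel k hk hz hz
  have e : ∀ m, kernelCoeff k z m * z ^ m =
      (((((m + k - 1).choose m : ℕ) : ℝ) * (‖z‖ ^ 2) ^ m : ℝ) : ℂ) := by
    intro m
    unfold kernelCoeff
    rw [mul_assoc, ← mul_pow, ← Complex.normSq_eq_conj_mul_self, Complex.normSq_eq_norm_sq]
    push_cast
    ring
  have e2 : kernel k z z = (((1 - ‖z‖ ^ 2)⁻¹ ^ k : ℝ) : ℂ) := by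
    unfold kernel
    rw [← Complex.normSq_eq_conj_mul_self, Complex.normSq_eq_norm_sq]
    push_cast
    ring
  simp_rw [e, e2] at h
  exact Complex.hasSum_ofReal.mp h

/-! ### The monomial Schur relation -/

/-- **Schur orthogonality for the monomials** against `μ_R`:
`∫ |⟨π_k(g) zᵐ, h⟩_k|² dμ_R = ⟨zᵐ, zᵐ⟩_k ⟨h, h⟩_k / (k - 1)` for every `m` and every `h ∈ A_k`. -/
theorem integral_norm_matrixCoeff_monomial_sq_ruhl (k : ℕ) (hk : 2 ≤ k) (b : ℕ → ℂ) (h : ℂ → ℂ)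
    (hh : ∀ w ∈ ball (0 : ℂ) 1, HasSum (fun n => b n * w ^ n) (h w))
    (hhint : IntegrableOn (fun w => ‖h w‖ ^ 2 * (1 - ‖w‖ ^ 2) ^ (k - 2)) (ball (0 : ℂ) 1)) (m : ℕ) :
    ∫ g, ‖matrixCoeff k (fun w => w ^ m) h g‖ ^ 2 ∂ruhl =
      monomialNormSq k m * (pairing k h h).re / ((k : ℝ) - 1) := by
  have hk1 : (0 : ℝ) < (k : ℝ) - 1 := by
    have : (2 : ℝ) ≤ k := by exact_mod_cast hk
    linarith
  have hC0 : ∀ m, (0 : ℝ) < (((m + k - 1).choose m : ℕ) : ℝ) := fun m => by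
    have := Nat.choose_pos (show m ≤ m + k - 1 by omega)
    exact_mod_cast this
  have hP0 : 0 ≤ (pairing k h h).re := (pairing_self_nonneg k h).1
  -- the two power series in `x = |z|²`
  have key : ∀ x ∈ Set.Ico (0 : ℝ) 1,
      HasSum (fun m => ((((m + k - 1).choose m : ℕ) : ℝ) ^ 2 *
          ∫ g, ‖matrixCoeff k (fun w => w ^ m) h g‖ ^ 2 ∂ruhl) * x ^ m)
        (π / ((k : ℝ) - 1) * (1 - x)⁻¹ ^ k * (pairing k h h).re / ((k : ℝ) - 1)) ∧
      HasSum (fun m => ((((m + k - 1).choose m : ℕ) : ℝ) *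
          (π / ((k : ℝ) - 1) * (pairing k h h).re / ((k : ℝ) - 1))) * x ^ m)
        (π / ((k : ℝ) - 1) * (1 - x)⁻¹ ^ k * (pairing k h h).re / ((k : ℝ) - 1)) := by
    intro x hx
    set z : ℂ := ((Real.sqrt x : ℝ) : ℂ) with hzdef
    have hzn : ‖z‖ ^ 2 = x := by
      rw [hzdef, Complex.norm_real, Real.norm_eq_abs, abs_of_nonneg (Real.sqrt_nonneg x),
        Real.sq_sqrt hx.1]
    have hz : z ∈ ball (0 : ℂ) 1 := by
      rw [mem_ball_zero_iff, hzdef, Complex.norm_real, Real.norm_eq_abs,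
        abs_of_nonneg (Real.sqrt_nonneg x)]
      exact (Real.sqrt_lt' one_pos).mpr (by rw [one_pow]; exact hx.2)
    constructor
    · have h1 := hasSum_integral_norm_matrixCoeff_sq ruhl k hk (kernelCoeff k z) (kernel k z)
        (differentiableOn_kernel k hz) (fun w hw => hasSum_kernel k hk hz hw) (integrableOn_kernel k hz)
        b h hh hhint (integrable_norm_matrixCoeff_kernel_sq ruhl k hk hz b h hh hhint).1
      rw [integral_norm_matrixCoeff_kernel_sq_ruhl k hk hz b h hh hhint, pairing_kernel_self k hk hz,
        ← Complex.ofReal_mul, Complex.ofReal_re, hzn] at h1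
      simp_rw [norm_kernelCoeff_sq, hzn] at h1
      exact h1.congr_fun fun m => by ring
    · have h2 := (hasSum_choose_mul_pow k hk hz).mul_right
        (π / ((k : ℝ) - 1) * (pairing k h h).re / ((k : ℝ) - 1))
      rw [hzn] at h2
      have ev : π / ((k : ℝ) - 1) * (1 - x)⁻¹ ^ k * (pairing k h h).re / ((k : ℝ) - 1) =
          (1 - x)⁻¹ ^ k * (π / ((k : ℝ) - 1) * (pairing k h h).re / ((k : ℝ) - 1)) := by ring
      rw [ev]
      exact h2.congr_fun fun m => by ring
  have hab := coeff_eq_of_hasSum_eq (fun m => by positivity) (fun m => by positivity)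
    (fun x hx => (key x hx).1) (fun x hx => (key x hx).2)
  have hm := congrFun hab m
  have hCm : (((m + k - 1).choose m : ℕ) : ℝ) ≠ 0 := (hC0 m).ne'
  have hmono : (((m + k - 1).choose m : ℕ) : ℝ) * monomialNormSq k m = π / ((k : ℝ) - 1) :=
    choose_mul_monomialNormSq k hk m
  have h1 : (((m + k - 1).choose m : ℕ) : ℝ) * ∫ g, ‖matrixCoeff k (fun w => w ^ m) h g‖ ^ 2 ∂ruhl =
      π / ((k : ℝ) - 1) * (pairing k h h).re / ((k : ℝ) - 1) := by
    apply mul_left_cancel₀ hCm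
    rw [← mul_assoc, ← sq]
    exact hm
  apply mul_left_cancel₀ hCm
  rw [h1]
  linear_combination (-(pairing k h h).re / ((k : ℝ) - 1)) * hmono

/-! ### The general Schur relation -/

/-- **Schur orthogonality with both vectors arbitrary** (Taylor form): for holomorphic
`f = Σ a_m zᵐ ∈ A_k` and `h ∈ A_k`, the matrix coefficient `g ↦ ⟨π_k(g) f, h⟩_k` is square-integrable
against `μ_R` and `∫ |⟨π_k(g) f, h⟩_k|² dμ_R = ⟨f, f⟩_k ⟨h, h⟩_k / (k - 1)`. -/
theorem integral_norm_matrixCoeff_sq_ruhl (k : ℕ) (hk : 2 ≤ k) (a : ℕ → ℂ) (f : ℂ → ℂ)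
    (hf : DifferentiableOn ℂ f (ball 0 1))
    (hfa : ∀ w ∈ ball (0 : ℂ) 1, HasSum (fun m => a m * w ^ m) (f w))
    (hfint : IntegrableOn (fun w => ‖f w‖ ^ 2 * (1 - ‖w‖ ^ 2) ^ (k - 2)) (ball (0 : ℂ) 1))
    (b : ℕ → ℂ) (h : ℂ → ℂ) (hh : ∀ w ∈ ball (0 : ℂ) 1, HasSum (fun n => b n * w ^ n) (h w))
    (hhint : IntegrableOn (fun w => ‖h w‖ ^ 2 * (1 - ‖w‖ ^ 2) ^ (k - 2)) (ball (0 : ℂ) 1)) :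
    Integrable (fun g => ‖matrixCoeff k f h g‖ ^ 2) ruhl ∧
      ∫ g, ‖matrixCoeff k f h g‖ ^ 2 ∂ruhl =
        (pairing k f f).re * (pairing k h h).re / ((k : ℝ) - 1) := by
  have hmono := integral_norm_matrixCoeff_monomial_sq_ruhl k hk b h hh hhint
  have hpars : HasSum (fun m => ‖a m‖ ^ 2 * monomialNormSq k m) (pairing k f f).re :=
    hasSum_pairing_self k hk a f hfa hfint
  have hsum : HasSum (fun m => ‖a m‖ ^ 2 * ∫ g, ‖matrixCoeff k (fun w => w ^ m) h g‖ ^ 2 ∂ruhl)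
      ((pairing k f f).re * (pairing k h h).re / ((k : ℝ) - 1)) := by
    have := hpars.mul_right ((pairing k h h).re / ((k : ℝ) - 1))
    simp_rw [hmono]
    have ev : (pairing k f f).re * (pairing k h h).re / ((k : ℝ) - 1) =
        (pairing k f f).re * ((pairing k h h).re / ((k : ℝ) - 1)) := by ring
    rw [ev]
    exact this.congr_fun fun m => by ring
  have hint := integrable_norm_matrixCoeff_sq_of_summable ruhl k hk a f hf hfa hfint b h hh hhint
    hsum.summable
  exact ⟨hint, (hasSum_integral_norm_matrixCoeff_sq ruhl k hk a f hf hfa hfint b h hh hhint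
    hint).unique hsum⟩

/-- **SCHUR ORTHOGONALITY, both vectors arbitrary**: for holomorphic `f, h ∈ A_k` (`k ≥ 2`),
`∫_G |⟨π_k(g) f, h⟩_k|² dμ_R = ⟨f, f⟩_k ⟨h, h⟩_k / (k - 1)` — the formal degree of the weight-`k` model
is `d = k - 1 = 2 k_R - 1` on EVERY pair of vectors (`f = 1` is `T5BergmanSchur`). -/
theorem schur (k : ℕ) (hk : 2 ≤ k) (f h : ℂ → ℂ) (hf : DifferentiableOn ℂ f (ball 0 1))
    (hfint : IntegrableOn (fun w => ‖f w‖ ^ 2 * (1 - ‖w‖ ^ 2) ^ (k - 2)) (ball (0 : ℂ) 1))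
    (hh : DifferentiableOn ℂ h (ball 0 1))
    (hhint : IntegrableOn (fun w => ‖h w‖ ^ 2 * (1 - ‖w‖ ^ 2) ^ (k - 2)) (ball (0 : ℂ) 1)) :
    ∫ g, ‖pairing k (act k g f) h‖ ^ 2 ∂ruhl =
      (pairing k f f).re * (pairing k h h).re / ((k : ℝ) - 1) :=
  (integral_norm_matrixCoeff_sq_ruhl k hk _ f hf (hasSum_taylor f hf) hfint _ h (hasSum_taylor h hh)
    hhint).2

/-- **Every matrix coefficient of the model is square-integrable** against `μ_R`. -/
theorem integrable_norm_matrixCoeff_sq (k : ℕ) (hk : 2 ≤ k) (f h : ℂ → ℂ)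
    (hf : DifferentiableOn ℂ f (ball 0 1))
    (hfint : IntegrableOn (fun w => ‖f w‖ ^ 2 * (1 - ‖w‖ ^ 2) ^ (k - 2)) (ball (0 : ℂ) 1))
    (hh : DifferentiableOn ℂ h (ball 0 1))
    (hhint : IntegrableOn (fun w => ‖h w‖ ^ 2 * (1 - ‖w‖ ^ 2) ^ (k - 2)) (ball (0 : ℂ) 1)) :
    Integrable (fun g => ‖pairing k (act k g f) h‖ ^ 2) ruhl :=
  (integral_norm_matrixCoeff_sq_ruhl k hk _ f hf (hasSum_taylor f hf) hfint _ h (hasSum_taylor h hh)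
    hhint).1

/-- **Positivity**: `∫_G |⟨π_k(g) f, h⟩_k|² dμ_R > 0` for `f, h ∈ A_k` both non-zero (`⟨f,f⟩_k, ⟨h,h⟩_k > 0`). -/
theorem schur_pos (k : ℕ) (hk : 2 ≤ k) (f h : ℂ → ℂ) (hf : DifferentiableOn ℂ f (ball 0 1))
    (hfint : IntegrableOn (fun w => ‖f w‖ ^ 2 * (1 - ‖w‖ ^ 2) ^ (k - 2)) (ball (0 : ℂ) 1))
    (hh : DifferentiableOn ℂ h (ball 0 1))
    (hhint : IntegrableOn (fun w => ‖h w‖ ^ 2 * (1 - ‖w‖ ^ 2) ^ (k - 2)) (ball (0 : ℂ) 1))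
    (hf0 : 0 < (pairing k f f).re) (hh0 : 0 < (pairing k h h).re) :
    0 < ∫ g, ‖pairing k (act k g f) h‖ ^ 2 ∂ruhl := by
  rw [schur k hk f h hf hfint hh hhint]
  have : (2 : ℝ) ≤ k := by exact_mod_cast hk
  have hk1 : (0 : ℝ) < (k : ℝ) - 1 := by linarith
  positivity

/-- **`π₃⁺` (weight `3`, Rühl's `(3/2, +)`): Schur orthogonality with formal degree `2` for every pair**:
`∫_G |⟨π₃(g) f, h⟩₃|² dμ_R = ⟨f, f⟩₃ ⟨h, h⟩₃ / 2`. -/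
theorem schur_three (f h : ℂ → ℂ) (hf : DifferentiableOn ℂ f (ball 0 1))
    (hfint : IntegrableOn (fun w => ‖f w‖ ^ 2 * (1 - ‖w‖ ^ 2) ^ (3 - 2)) (ball (0 : ℂ) 1))
    (hh : DifferentiableOn ℂ h (ball 0 1))
    (hhint : IntegrableOn (fun w => ‖h w‖ ^ 2 * (1 - ‖w‖ ^ 2) ^ (3 - 2)) (ball (0 : ℂ) 1)) :
    ∫ g, ‖pairing 3 (act 3 g f) h‖ ^ 2 ∂ruhl = (pairing 3 f f).re * (pairing 3 h h).re / 2 := by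
  rw [schur 3 (by norm_num) f h hf hfint hh hhint]
  norm_num

end Summit.Ventures.HodgeRepro2.T5BergmanSchurGeneral
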